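import Summits.QuantumAdvantage.QuantumAdvantage.Theorems.NearExactIsExact.Negative.BqqNineTen
import Summits.QuantumAdvantage.QuantumAdvantage.Theorems.NearExactIsExact.Negative.IsolatingFlat
import Summits.QuantumAdvantage.QuantumAdvantage.Theorems.NearExactIsExact.Negative.MmFormDichotomy

/-!
# `NearExactIsExact` (stmt-QuantumAdvantage-14043) — negative side: **BQQ for frame-preserving ("triangular")
  biquadratic maps with a 3-bit nonlinear block, in EVERY dimension** (THEOREM BQQ^tri₃ of DISPROOF §45)

Setting (b2b cell, DISPROOF §45 — THEOREM BQQ^tri₃ / PC6♯): `π, τ` mutually inverse coordinatewise-quadratic maps of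
`𝔽₂^{k+3}` that PRESERVE the first `k` coordinates ("frame" `t`; the last three are the nonlinear block `y`):
`π(t ‖ y) = (t ‖ π_t(y))`.  These are exactly the maps produced by the aligned Maiorana–McFarland normal form of a
projection–concatenation pair over 6-variable slices (§45.3).  For cubic `c₁, c₂` the residual
`R = c₁ ⊕ c₂∘π` has SLICES `R_t = R(t ‖ ·)` on `𝔽₂³`.
* `window_of_bqq` (restriction): for ANY map `φ : 𝔽₂^j → 𝔽₂^k` with affine coordinates (a chart of a `j`-flat of
  the frame, possibly degenerate), the pulled-back configuration `π'(s ‖ y) = (s ‖ π_{φ s}(y))` on `𝔽₂^{j+3}` is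
  again a pair of mutually inverse coordinatewise-quadratic maps with cubic `c_i ∘ (φ × id)`, and its residual weight
  is `Σ_s wt(R_{φ s})`; so every BQQ window on `j + 3` bits bounds that slice sum:
  `window_four` (`bqq_seven`): `Σ_{s ∈ 𝔽₂⁴} wt(R_{φ s}) = 0` or `≥ 8`;  `window_six` (`bqq_nine`): `… = 0` or `≥ 16`.
* `bqq_triangular`: `R ≡ 0` or `8·wt(R) ≥ 2^{k+1}` (i.e. `wt(R) ≥ 2^{m-5}`, `m = k + 3`; `bqq_triangular'`), from
  the windows, isolating flats (`IsolatingFlat.exists_affine_isolating`) and constant slice parity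
  (`IsolatingFlat.slice_weights_even`).
* `mmForm_gap_triangular`: hence every cubic `f` and MM sign-form `g` over such a `π` (cubic dual word) have
  `Φ(f,g) = 1 ∨ Φ(f,g) ≤ 15/16`, at every `n = 2(k+3)` (as `mmForm_gap_of_bqq`, with `bqq_triangular` for BQQ).
Consequence recorded in DISPROOF §45 (THEOREM PC6♯): every projection–concatenation pair over 6-variable jointly-cubic
slices has `Φ = 1` or `Φ ≤ 15/16` against any cubic partner, in every even dimension — that habitat cannot refute
the crux.  HONEST FRAMING: a structural theorem on the NEGATIVE side of the crux (it closes a disproof habitat); no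
Theses statement is asserted; standard axioms; NOT summit progress.
-/

set_option linter.dupNamespace false -- D-0017: single-problem summit ⇒ `QuantumAdvantage.QuantumAdvantage` by design

namespace Summit.QuantumAdvantage.QuantumAdvantage.Theorems.NearExactIsExact.Negative.TriangularBqq

open Finset
open Literature.Computability.QuantumComplexity
open Literature.Computability.QuantumComplexity.BuzetChailloux (zeroVec)
open Summit.QuantumAdvantage.QuantumAdvantage.Theorems.CubicForrelation.NearExactIsExact
  (fc_isDegLeFun_comp fc_sum_signOf_eq_card acx_deg_coord_append_right)
open Summit.QuantumAdvantage.QuantumAdvantage.Theorems.NearExactIsExact.Negative.MmFormDichotomy (mmForm_dichotomy)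
open Summit.QuantumAdvantage.QuantumAdvantage.Theorems.NearExactIsExact.Negative.ProjectionConcat (card_filter_append)
open Summit.QuantumAdvantage.QuantumAdvantage.Theorems.NearExactIsExact.Negative.BqqSeven (bqq_seven)
open Summit.QuantumAdvantage.QuantumAdvantage.Theorems.NearExactIsExact.Negative.BqqNineTen (bqq_nine)
open Summit.QuantumAdvantage.QuantumAdvantage.Theorems.NearExactIsExact.Negative.IsolatingFlat
  (exists_affine_isolating slice_weights_even)

variable {k : ℕ}
/-- **Restriction / window transfer.** Let `π, τ` be mutually inverse coordinatewise-quadratic maps of `𝔽₂^{k+3}`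
with `π` preserving the first `k` coordinates, `c₁, c₂` cubic, and `φ : 𝔽₂^j → 𝔽₂^k` a map with affine
coordinates. If every biquadratic configuration on `j + 3` bits has residual weight `0` or `≥ W` (a BQQ window), then
`Σ_s #{y : c₁(φ s ‖ y) ≠ c₂(π(φ s ‖ y))}` is `0` (all these slices vanish) or `≥ W`. -/
theorem window_of_bqq (j W : ℕ)
    (hbqq : ∀ (π' τ' : (Fin (j + 3) → Bool) → (Fin (j + 3) → Bool)),
      (∀ i, IsDegLeFun 2 (fun y => π' y i)) → (∀ i, IsDegLeFun 2 (fun x => τ' x i)) → (∀ y, τ' (π' y) = y) →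
      ∀ (c₁ c₂ : (Fin (j + 3) → Bool) → Bool), IsDegLeFun 3 c₁ → IsDegLeFun 3 c₂ →
        (∀ y, c₁ y = c₂ (π' y)) ∨ W ≤ #(univ.filter fun y => (c₁ y ^^ c₂ (π' y)) = true))
    (π τ : (Fin (k + 3) → Bool) → (Fin (k + 3) → Bool))
    (hπ : ∀ i, IsDegLeFun 2 (fun z => π z i)) (hτ : ∀ i, IsDegLeFun 2 (fun z => τ z i))
    (hτπ : ∀ z, τ (π z) = z) (hpres : ∀ z (i : Fin k), π z (Fin.castAdd 3 i) = z (Fin.castAdd 3 i))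
    (c₁ c₂ : (Fin (k + 3) → Bool) → Bool) (h₁ : IsDegLeFun 3 c₁) (h₂ : IsDegLeFun 3 c₂)
    (φ : (Fin j → Bool) → (Fin k → Bool)) (hφ : ∀ x, IsDegLeFun 1 (fun s => φ s x)) :
    (∀ s y, c₁ (Fin.append (φ s) y) = c₂ (π (Fin.append (φ s) y))) ∨
      W ≤ ∑ s : Fin j → Bool,
        #(univ.filter fun y : Fin 3 → Bool => (c₁ (Fin.append (φ s) y) ^^ c₂ (π (Fin.append (φ s) y))) = true) := by
  classical
  -- the chart `Ψ(s ‖ y) = (φ s ‖ y)` and the pulled-back maps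
  set Ψ : (Fin (j + 3) → Bool) → (Fin (k + 3) → Bool) :=
    fun z => Fin.append (φ (fun i => z (Fin.castAdd 3 i))) (fun i => z (Fin.natAdd j i)) with hΨ
  set π' : (Fin (j + 3) → Bool) → (Fin (j + 3) → Bool) :=
    fun z => Fin.append (fun i => z (Fin.castAdd 3 i)) (fun i => π (Ψ z) (Fin.natAdd k i)) with hπ'
  set τ' : (Fin (j + 3) → Bool) → (Fin (j + 3) → Bool) :=
    fun z => Fin.append (fun i => z (Fin.castAdd 3 i)) (fun i => τ (Ψ z) (Fin.natAdd k i)) with hτ'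
  have hΨdeg : ∀ v, IsDegLeFun 1 (fun z => Ψ z v) := by
    intro v
    induction v using Fin.addCases with
    | left x =>
      simp only [hΨ, Fin.append_left]
      exact fc_isDegLeFun_comp (hφ x) (fun (z : Fin (j + 3) → Bool) (i : Fin j) => z (Fin.castAdd 3 i))
        (fun i => isDegLeFun_apply (Fin.castAdd 3 i) le_rfl) le_rfl
    | right i =>
      simp only [hΨ, Fin.append_right]
      exact isDegLeFun_apply (Fin.natAdd j i) le_rfl
  have hdeg' : ∀ (σ : (Fin (k + 3) → Bool) → (Fin (k + 3) → Bool)), (∀ i, IsDegLeFun 2 (fun z => σ z i)) →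
      ∀ v, IsDegLeFun 2 (fun z : Fin (j + 3) → Bool =>
        Fin.append (fun i => z (Fin.castAdd 3 i)) (fun i => σ (Ψ z) (Fin.natAdd k i)) v) := by
    intro σ hσ v
    induction v using Fin.addCases with
    | left x =>
      simp only [Fin.append_left]
      exact isDegLeFun_apply (Fin.castAdd 3 x) (by norm_num)
    | right i =>
      simp only [Fin.append_right]
      exact fc_isDegLeFun_comp (hσ (Fin.natAdd k i)) Ψ hΨdeg le_rfl
  have hπ'deg : ∀ v, IsDegLeFun 2 (fun z => π' z v) := hdeg' π hπ
  have hτ'deg : ∀ v, IsDegLeFun 2 (fun z => τ' z v) := hdeg' τ hτ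
  -- semi-conjugacy `Ψ ∘ π' = π ∘ Ψ` (uses that `π` preserves the frame coordinates)
  have hsemi : ∀ z, Ψ (π' z) = π (Ψ z) := by
    intro z
    funext v
    induction v using Fin.addCases with
    | left x =>
      rw [hpres]
      simp only [hΨ, hπ', Fin.append_left]
    | right i =>
      simp only [hΨ, hπ', Fin.append_right]
  have hinv : ∀ z, τ' (π' z) = z := by
    intro z
    funext v
    induction v using Fin.addCases with
    | left x => simp only [hτ', hπ', Fin.append_left]
    | right i =>
      have e : τ' (π' z) (Fin.natAdd j i) = τ (Ψ (π' z)) (Fin.natAdd k i) := by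
        simp only [hτ', Fin.append_right]
      rw [e, hsemi, hτπ]
      simp only [hΨ, Fin.append_right]
  have hc : ∀ c : (Fin (k + 3) → Bool) → Bool, IsDegLeFun 3 c → IsDegLeFun 3 (fun z => c (Ψ z)) :=
    fun c hcd => fc_isDegLeFun_comp hcd Ψ hΨdeg le_rfl
  have hΨapp : ∀ (s : Fin j → Bool) (y : Fin 3 → Bool), Ψ (Fin.append s y) = Fin.append (φ s) y := by
    intro s y
    simp only [hΨ, Fin.append_left, Fin.append_right]
  rcases hbqq π' τ' hπ'deg hτ'deg hinv (fun z => c₁ (Ψ z)) (fun z => c₂ (Ψ z)) (hc c₁ h₁) (hc c₂ h₂) with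
    hall | hW
  · left
    intro s y
    have e : c₁ (Ψ (Fin.append s y)) = c₂ (Ψ (π' (Fin.append s y))) := hall (Fin.append s y)
    rw [hsemi, hΨapp] at e
    exact e
  · right
    have e : #(univ.filter fun z : Fin (j + 3) → Bool => (c₁ (Ψ z) ^^ c₂ (Ψ (π' z))) = true) =
        ∑ s : Fin j → Bool, #(univ.filter fun y : Fin 3 → Bool =>
          (c₁ (Fin.append (φ s) y) ^^ c₂ (π (Fin.append (φ s) y))) = true) := by
      rw [card_filter_append]
      refine sum_congr rfl fun s _ => ?_
      congr 1
      ext y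
      simp only [mem_filter, mem_univ, true_and]
      rw [hsemi, hΨapp]
    simpa only [e] using hW

/-- **Window on 4-flats** (`bqq_seven` transported): `Σ_{s ∈ 𝔽₂⁴} wt(R_{φ s}) = 0` or `≥ 8`. -/
theorem window_four (π τ : (Fin (k + 3) → Bool) → (Fin (k + 3) → Bool))
    (hπ : ∀ i, IsDegLeFun 2 (fun z => π z i)) (hτ : ∀ i, IsDegLeFun 2 (fun z => τ z i))
    (hτπ : ∀ z, τ (π z) = z) (hpres : ∀ z (i : Fin k), π z (Fin.castAdd 3 i) = z (Fin.castAdd 3 i))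
    (c₁ c₂ : (Fin (k + 3) → Bool) → Bool) (h₁ : IsDegLeFun 3 c₁) (h₂ : IsDegLeFun 3 c₂)
    (φ : (Fin 4 → Bool) → (Fin k → Bool)) (hφ : ∀ x, IsDegLeFun 1 (fun s => φ s x)) :
    (∀ s y, c₁ (Fin.append (φ s) y) = c₂ (π (Fin.append (φ s) y))) ∨
      8 ≤ ∑ s : Fin 4 → Bool,
        #(univ.filter fun y : Fin 3 → Bool => (c₁ (Fin.append (φ s) y) ^^ c₂ (π (Fin.append (φ s) y))) = true) :=
  window_of_bqq 4 8 (fun π' τ' hπ' hτ' hτπ' c₁' c₂' h₁' h₂' => bqq_seven π' τ' hπ' hτ' hτπ' c₁' c₂' h₁' h₂')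
    π τ hπ hτ hτπ hpres c₁ c₂ h₁ h₂ φ hφ

/-- **Window on 6-flats** (`bqq_nine` transported): `Σ_{s ∈ 𝔽₂⁶} wt(R_{φ s}) = 0` or `≥ 16`. -/
theorem window_six (π τ : (Fin (k + 3) → Bool) → (Fin (k + 3) → Bool))
    (hπ : ∀ i, IsDegLeFun 2 (fun z => π z i)) (hτ : ∀ i, IsDegLeFun 2 (fun z => τ z i))
    (hτπ : ∀ z, τ (π z) = z) (hpres : ∀ z (i : Fin k), π z (Fin.castAdd 3 i) = z (Fin.castAdd 3 i))
    (c₁ c₂ : (Fin (k + 3) → Bool) → Bool) (h₁ : IsDegLeFun 3 c₁) (h₂ : IsDegLeFun 3 c₂)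
    (φ : (Fin 6 → Bool) → (Fin k → Bool)) (hφ : ∀ x, IsDegLeFun 1 (fun s => φ s x)) :
    (∀ s y, c₁ (Fin.append (φ s) y) = c₂ (π (Fin.append (φ s) y))) ∨
      16 ≤ ∑ s : Fin 6 → Bool,
        #(univ.filter fun y : Fin 3 → Bool => (c₁ (Fin.append (φ s) y) ^^ c₂ (π (Fin.append (φ s) y))) = true) :=
  window_of_bqq 6 16 (fun π' τ' hπ' hτ' hτπ' c₁' c₂' h₁' h₂' => bqq_nine π' τ' hπ' hτ' hτπ' c₁' c₂' h₁' h₂')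
    π τ hπ hτ hτπ hpres c₁ c₂ h₁ h₂ φ hφ

/-! ### Assembly: BQQ for frame-preserving ("triangular") biquadratic maps with a 3-bit block, all `k` -/

/-- **THEOREM BQQ^tri₃** (DISPROOF §45.4, all dimensions). Let `π, τ` be mutually inverse coordinatewise-quadratic
maps of `𝔽₂^{k+3}` with `π` preserving the first `k` coordinates, and `c₁, c₂` cubic. Then the residual
`R = c₁ ⊕ c₂∘π` is identically zero or has weight `≥ 2^{k+1}/8 = 2^{m-5}` (`m = k + 3`).
Proof: isolating 4-flats + `window_four` force `|N|·16 ≥ 2^{k+1}` as soon as one defective slice is not full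
(`N` = defective slices), and then constant slice parity gives weight `≥ 2|N|` (even case) or `≥ 2^k` (odd case);
if all defective slices are full, isolating 6-flats + `window_six` force `|N|·64 ≥ 2^{k+1}` and the weight is `8|N|`. -/
theorem bqq_triangular (π τ : (Fin (k + 3) → Bool) → (Fin (k + 3) → Bool))
    (hπ : ∀ i, IsDegLeFun 2 (fun z => π z i)) (hτ : ∀ i, IsDegLeFun 2 (fun z => τ z i))
    (hτπ : ∀ z, τ (π z) = z) (hpres : ∀ z (i : Fin k), π z (Fin.castAdd 3 i) = z (Fin.castAdd 3 i))
    (c₁ c₂ : (Fin (k + 3) → Bool) → Bool) (h₁ : IsDegLeFun 3 c₁) (h₂ : IsDegLeFun 3 c₂) :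
    (∀ z, c₁ z = c₂ (π z)) ∨
      2 ^ (k + 1) ≤ 8 * #(univ.filter fun z : Fin (k + 3) → Bool => (c₁ z ^^ c₂ (π z)) = true) := by
  classical
  -- slice weights
  set w : (Fin k → Bool) → ℕ := fun t =>
    #(univ.filter fun y : Fin 3 → Bool => (c₁ (Fin.append t y) ^^ c₂ (π (Fin.append t y))) = true) with hw
  have htot : #(univ.filter fun z : Fin (k + 3) → Bool => (c₁ z ^^ c₂ (π z)) = true) = ∑ t, w t :=
    card_filter_append (n₁ := k) (n₂ := 3) _
  have hw8 : ∀ t, w t ≤ 8 := fun t =>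
    (card_filter_le _ _).trans (by rw [card_univ, Fintype.card_fun, Fintype.card_bool, Fintype.card_fin]; norm_num)
  have hpar : ∀ t t', Even (w t + w t') := slice_weights_even π τ hτπ hpres c₁ c₂ h₁ h₂
  -- defective slices
  set N : Finset (Fin k → Bool) := univ.filter fun t => w t ≠ 0 with hN
  have hsumN : ∑ t ∈ N, w t = ∑ t, w t := sum_filter_ne_zero _
  have hzero : ∀ t, t ∉ N → w t = 0 := fun t ht => by
    by_contra h
    exact ht (mem_filter.2 ⟨mem_univ _, h⟩)
  -- the isolating-window bound: a defective slice lighter than the window `W` on `j`-flats forces `|N|·2^j ≥ 2^{k+1}`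
  have key : ∀ (j W : ℕ),
      (∀ (φ : (Fin j → Bool) → (Fin k → Bool)), (∀ x, IsDegLeFun 1 (fun s => φ s x)) →
        (∀ s y, c₁ (Fin.append (φ s) y) = c₂ (π (Fin.append (φ s) y))) ∨
          W ≤ ∑ s : Fin j → Bool, w (φ s)) →
      ∀ t₀, w t₀ ≠ 0 → w t₀ < W → 2 ^ (k + 1) ≤ #N * 2 ^ j := by
    intro j W hwin t₀ h0 hlt
    by_contra hlt'
    obtain ⟨φ, hφ, hφ0, hφN⟩ := exists_affine_isolating N t₀ j (not_le.1 hlt')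
    rcases hwin φ hφ with hall | hW
    · apply h0
      rw [hw]
      refine card_eq_zero.2 (filter_eq_empty_iff.2 fun y _ => ?_)
      show ¬ ((c₁ (Fin.append t₀ y) ^^ c₂ (π (Fin.append t₀ y))) = true)
      have e := hall (fun _ => false) y
      rw [hφ0] at e
      rw [e, Bool.xor_self]
      exact Bool.false_ne_true
    · have hs : ∑ s : Fin j → Bool, w (φ s) = w t₀ := by
        rw [Finset.sum_eq_single_of_mem (fun _ => false) (mem_univ _) fun s _ hs => hzero _ (hφN s hs), hφ0]
      rw [hs] at hW
      exact absurd hW (not_le.2 hlt)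
  by_cases hNe : N = ∅
  · left
    intro z
    have hz : w (fun i => z (Fin.castAdd 3 i)) = 0 := by
      refine hzero _ ?_
      rw [hNe]
      simp
    have hz' := filter_eq_empty_iff.1 (card_eq_zero.1 hz) (mem_univ (fun i => z (Fin.natAdd k i)))
    rw [Fin.append_castAdd_natAdd] at hz'
    revert hz'
    cases c₁ z <;> cases c₂ (π z) <;> simp
  · right
    rw [htot, ← hsumN]
    by_cases hfull : ∀ t ∈ N, w t = 8
    · -- CASE B: all defective slices full; 6-flat windows
      obtain ⟨t₀, ht₀⟩ := nonempty_iff_ne_empty.2 hNe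
      have h0 : w t₀ ≠ 0 := (mem_filter.1 ht₀).2
      have h64 := key 6 16 (fun φ hφ => window_six π τ hπ hτ hτπ hpres c₁ c₂ h₁ h₂ φ hφ) t₀ h0
        (by rw [hfull t₀ ht₀]; norm_num)
      have hs : ∑ t ∈ N, w t = 8 * #N := by
        rw [sum_congr rfl hfull, sum_const, smul_eq_mul, mul_comm]
      rw [hs]
      calc 2 ^ (k + 1) ≤ #N * 2 ^ 6 := h64
        _ = 8 * (8 * #N) := by ring
    · -- CASE A: a defective slice that is not full; 4-flat windows + parity
      push Not at hfull
      obtain ⟨t₁, ht₁, hne⟩ := hfull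
      have h0 : w t₁ ≠ 0 := (mem_filter.1 ht₁).2
      have hlt : w t₁ < 8 := lt_of_le_of_ne (hw8 t₁) hne
      have h16 := key 4 8 (fun φ hφ => window_four π τ hπ hτ hτπ hpres c₁ c₂ h₁ h₂ φ hφ) t₁ h0 hlt
      rcases Nat.even_or_odd (w t₁) with hev | hodd
      · -- all defective slices are even, hence of weight ≥ 2
        have h2 : ∀ t ∈ N, 2 ≤ w t := by
          intro t ht
          have ht0 : w t ≠ 0 := (mem_filter.1 ht).2
          have hte : Even (w t) := by
            have := hpar t t₁
            obtain ⟨a, ha⟩ := this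
            obtain ⟨b, hb⟩ := hev
            exact ⟨a - b, by omega⟩
          obtain ⟨a, ha⟩ := hte
          omega
        have hs : 2 * #N ≤ ∑ t ∈ N, w t := by
          rw [mul_comm]
          have := Finset.card_nsmul_le_sum N w 2 h2
          simpa [smul_eq_mul] using this
        calc 2 ^ (k + 1) ≤ #N * 2 ^ 4 := h16
          _ = 8 * (2 * #N) := by ring
          _ ≤ 8 * ∑ t ∈ N, w t := Nat.mul_le_mul_left _ hs
      · -- all slices are odd, hence every slice is defective
        have h1 : ∀ t, 1 ≤ w t := by
          intro t
          obtain ⟨a, ha⟩ := hpar t t₁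
          obtain ⟨b, hb⟩ := hodd
          omega
        have hs : 2 ^ k ≤ ∑ t, w t := by
          have := Finset.card_nsmul_le_sum (univ : Finset (Fin k → Bool)) w 1 fun t _ => h1 t
          rw [card_univ, Fintype.card_fun, Fintype.card_bool, Fintype.card_fin, smul_eq_mul, mul_one] at this
          exact this
        rw [hsumN]
        calc 2 ^ (k + 1) = 2 * 2 ^ k := by ring
          _ ≤ 8 * 2 ^ k := by omega
          _ ≤ 8 * ∑ t, w t := Nat.mul_le_mul_left _ hs

/-- The same bound in the `2^{m-5}` form of DISPROOF §45 (`m = k + 3 ≥ 5`). -/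
theorem bqq_triangular' (hk : 2 ≤ k) (π τ : (Fin (k + 3) → Bool) → (Fin (k + 3) → Bool))
    (hπ : ∀ i, IsDegLeFun 2 (fun z => π z i)) (hτ : ∀ i, IsDegLeFun 2 (fun z => τ z i))
    (hτπ : ∀ z, τ (π z) = z) (hpres : ∀ z (i : Fin k), π z (Fin.castAdd 3 i) = z (Fin.castAdd 3 i))
    (c₁ c₂ : (Fin (k + 3) → Bool) → Bool) (h₁ : IsDegLeFun 3 c₁) (h₂ : IsDegLeFun 3 c₂) :
    (∀ z, c₁ z = c₂ (π z)) ∨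
      2 ^ (k - 2) ≤ #(univ.filter fun z : Fin (k + 3) → Bool => (c₁ z ^^ c₂ (π z)) = true) := by
  rcases bqq_triangular π τ hπ hτ hτπ hpres c₁ c₂ h₁ h₂ with h | h
  · exact Or.inl h
  · right
    obtain ⟨d, rfl⟩ := Nat.exists_eq_add_of_le hk
    rw [show 2 + d - 2 = d from by omega]
    have e : 2 ^ (2 + d + 1) = 8 * 2 ^ d := by ring
    rw [e] at h
    exact Nat.le_of_mul_le_mul_left h (by norm_num)


/-! ### Consequence: one-sided MM gap over frame-preserving maps at every `n = 2(k+3)` -/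

/-- **One-sided MM gap over frame-preserving maps, all `n = 2(k+3)`.** Every cubic `f` and every `g` in
Maiorana–McFarland sign form over a coordinatewise-quadratic `π : 𝔽₂^{k+3} → 𝔽₂^{k+3}` preserving the first `k`
coordinates, with cubic dual word `h`, satisfy `Φ(f,g) = 1 ∨ Φ(f,g) ≤ 15/16` (`mmForm_dichotomy` + `bqq_triangular`,
exactly as `mmForm_gap_of_bqq`; this is the aligned 6-variable-slice pc habitat of DISPROOF §45 at every even `n`). -/
theorem mmForm_gap_triangular (f g : (Fin ((k + 3) + (k + 3)) → Bool) → Bool)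
    (π : (Fin (k + 3) → Bool) → (Fin (k + 3) → Bool)) (h : (Fin (k + 3) → Bool) → Bool)
    (hf : IsDegLeFun 3 f) (hπ : ∀ i, IsDegLeFun 2 (fun y => π y i))
    (hpres : ∀ z (i : Fin k), π z (Fin.castAdd 3 i) = z (Fin.castAdd 3 i)) (hh : IsDegLeFun 3 h)
    (hg : ∀ y₁ y₂ : Fin (k + 3) → Bool, signOf (g (Fin.append y₁ y₂)) = twist y₁ (π y₂) * signOf (h y₂)) :
    forrelation f g = 1 ∨ forrelation f g ≤ 15 / 16 := by
  classical
  rcases mmForm_dichotomy f g π h hf hπ hg with hle | ⟨τ, hτ, hτπ, hΦ⟩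
  · exact Or.inr hle
  have hk : IsDegLeFun 3 (fun a : Fin (k + 3) → Bool => f (Fin.append a zeroVec)) :=
    fc_isDegLeFun_comp hf (fun a : Fin (k + 3) → Bool => Fin.append a zeroVec) (acx_deg_coord_append_right zeroVec)
      (by norm_num)
  have hpos : (0 : ℝ) < 2 ^ (k + 3) := by positivity
  rw [hΦ]
  rcases bqq_triangular π τ hπ hτ hτπ hpres h (fun a => f (Fin.append a zeroVec)) hh hk with h0 | hw
  · left
    rw [show ∑ y, signOf (h y ^^ f (Fin.append (π y) zeroVec)) = ∑ _y : Fin (k + 3) → Bool, (1 : ℝ) from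
      sum_congr rfl fun y _ => by rw [h0 y, Bool.xor_self]; rfl, sum_const, card_univ, Fintype.card_fun,
      Fintype.card_bool, Fintype.card_fin, nsmul_eq_mul, mul_one]
    push_cast
    exact inv_mul_cancel₀ hpos.ne'
  · right
    have hw2 : 2 ^ (k + 3) ≤ 32 * #(univ.filter fun y : Fin (k + 3) → Bool =>
        (h y ^^ f (Fin.append (π y) zeroVec)) = true) := by
      have e : 2 ^ (k + 3) = 4 * 2 ^ (k + 1) := by ring
      omega
    have hw' := (Nat.cast_le (α := ℝ)).2 hw2
    push_cast at hw'
    rw [fc_sum_signOf_eq_card, inv_mul_le_iff₀ hpos]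
    linarith

end Summit.QuantumAdvantage.QuantumAdvantage.Theorems.NearExactIsExact.Negative.TriangularBqq
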